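import Summits.QuantumFields.BalabanUV.T4Continuum.Support.CTWeightedCoercivity
import Summits.QuantumFields.BalabanUV.T4Continuum.Support.ScalarCovariantCTDefects
import Summits.QuantumFields.BalabanUV.T4Continuum.Support.ScalarAveragedCompression
import Summits.QuantumFields.BalabanUV.T4Continuum.Support.CovariantBlockAveraging

/-!
# T⁴ programme, SUBSTRATE (shared lattice-gauge analysis library) — THE CONJUGATED KERNEL `conjMat` AS A DIAGONAL CONJUGATION, AND THE
# BRIDGE ∕ PRODUCT ∕ INVERSE RULES for `‖conjMat X − X‖` and the SCHUR CONJUGATION BOUND for finite-range rectangular kernels (programme VEC, file 2a)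

Substrate cell `b2b-balaban-substrate-*`, seat p3.  `CTWeightedCoercivity` (VEC-1) reduced the Combes–Thomas decay of an operator with a bounded
non-local part to `ConjDefect` ∕ `WCoercive` data; the non-local part of Bałaban's propagators — the projection term `∂P∂*` of
[Balaban1984PropagatorsI] (1.69)–(1.70) p.29–30 ∕ `DR(U)D*` of [Balaban1985BackgroundPropagators] (3.26) p.395 — is a PRODUCT of local rectangular
pieces (`∂`, `Q̃′`) and inverses (`G′ = (Δ′)⁻¹`, `(Q̃′G′²Q̃′ᴴ)⁻¹`).  THIS FILE supplies the algebra and the local bounds: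

 * §1 `conjMat κ ρ σ X = diag(e^{κρ})·X·diag(e^{−κσ})` (`conjMat_eq_diag_mul`), hence `conjMat_inv` (square, same weights), the adjoint rule
   `conjMat_conjTranspose` (`conjMat κ σ ρ Xᴴ = (conjMat (−κ) ρ σ X)ᴴ`), `conjMat_of_sameWeight` (a kernel supported where the two weights agree is
   FIXED — site-diagonal pieces, `siteMul`), the bridge **`opNorm_conjMat_le_of_wbound`** (a weighted bound `‖e^{κρ}Xv‖ ≤ C‖e^{κσ}v‖` IS
   `‖conjMat X‖ ≤ C`), the PRODUCT rule **`opNorm_conjMat_mul_sub_le`** (`‖c(XY) − XY‖ ≤ ‖cX − X‖·‖cY‖ + ‖X‖·‖cY − Y‖`) and the INVERSE rule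
   **`opNorm_conjMat_inv_le`** ∕ **`opNorm_conjMat_inv_sub_le`** (`Coercive σ K`, `‖cK − K‖ ≤ δ < σ` ⟹ `‖(cK)⁻¹‖ ≤ (σ − δ)⁻¹`,
   `‖(cK)⁻¹ − K⁻¹‖ ≤ δ/((σ − δ)σ)`);
 * §2 the SCHUR conjugation bound **`opNorm_conjMat_sub_le_schur`**: if `|ρ_e − σ_{e′}| ≤ ℓ` on the support of `X` and the absolute row∕column
   sums of `X` are `≤ R, C`, then `‖conjMat κ ρ σ X − X‖ ≤ (e^{|κ|ℓ} − 1)·√(RC)`;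
 * the torus instances (`∂`, `∂ᴴ`, `Q̃′`, `Q̃′ᴴ`, `Π′`) are the companion file `Support/CTConjugationTorus`.

HONEST FRAMING (T4-DAG p. 1).  Generic ∕ `U = 1` lattice linear algebra ([folklore]); no estimate of any NE row; nothing printed is a hypothesis
or a conclusion; no `def … : Prop` fact (the `def`s are two weight functions); spine 0/9 unchanged; NOT infinite volume ∕ mass gap ∕ Clay.
HONEST DEPENDENCY: continuum YM on T⁴ ⇐ BetaPertH ∧ nine spine estimates (0/9 proved); BetaPertH ⇐ (D1) ∧ (D4) ∧ CAP+tail; G-an2-4 gates asym,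
D1 and NE2/3/4.  ABSOLUTE RULE kept; no `sorry`.
-/

noncomputable section

open scoped BigOperators ComplexConjugate Matrix Matrix.Norms.L2Operator ComplexOrder

namespace Summit.QuantumFields.BalabanUV.T4Continuum.CTConjugationPieces

open Literature.MathematicalPhysics.QuantumFieldTheory.Balaban1983to89.B5Prop11Plancherel (Tor fine unitVec)
open Literature.MathematicalPhysics.QuantumFieldTheory.Balaban1983to89.B5Action121 (sdiff GradOp)
open Literature.MathematicalPhysics.QuantumFieldTheory.Balaban1983to89.B5Block118 (QsOp bpt)
open Literature.MathematicalPhysics.QuantumFieldTheory.Balaban1983to89.B5Blocks16 (blockOf blockOf_bpt bpt_bijective)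
open Literature.MathematicalPhysics.QuantumFieldTheory.Balaban1983to89.B5Prop11Lower (nsq nsq_nonneg)
open Summit.QuantumFields.BalabanUV.T4Continuum
open Summit.QuantumFields.BalabanUV.T4Continuum.CoerciveInverseTower (Coercive isUnit_of_coercive opNorm_inv_le_of_coercive)
open Summit.QuantumFields.BalabanUV.T4Continuum.ScalarAveragedPropagator (opNorm_le_of_nsq_le_rect)
open Summit.QuantumFields.BalabanUV.T4Continuum.ScalarAveragedCompression (Qiso)
open Summit.QuantumFields.BalabanUV.T4Continuum.ScalarBlockPoincare (PiS QsOp_apply_blockOf)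
open Summit.QuantumFields.BalabanUV.T4Continuum.CovariantBlockAveraging (opNorm_le_sqrt_of_schur)
open Summit.QuantumFields.BalabanUV.T4Continuum.ScalarCovariantCTWeighted (wvec wvec_wvec_neg)
open Summit.QuantumFields.BalabanUV.T4Continuum.ScalarCovariantCTDefects (PiS_apply sum_ite_blockOf_eq)
open Summit.QuantumFields.BalabanUV.T4Continuum.CTWeightedCoercivity

/-! ## §1 `conjMat` as a diagonal conjugation; bridge, product and inverse rules -/

section Algebra

variable {ι τ : Type*} [Fintype ι] [DecidableEq ι] [Fintype τ] [DecidableEq τ]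

/-- the diagonal weight matrix `diag(e^{κρ})`. [folklore] -/
abbrev wdiag (κ : ℝ) (ρ : ι → ℝ) : Matrix ι ι ℂ := Matrix.diagonal fun e => ((Real.exp (κ * ρ e) : ℝ) : ℂ)

/-- `diag(e^{κρ})·diag(e^{−κρ}) = 1`. [folklore] -/
theorem wdiag_mul_wdiag_neg (κ : ℝ) (ρ : ι → ℝ) : wdiag κ ρ * wdiag (-κ) ρ = 1 := by
  rw [Matrix.diagonal_mul_diagonal, ← Matrix.diagonal_one]
  congr 1; funext e
  rw [← Complex.ofReal_mul, ← Real.exp_add, show κ * ρ e + -κ * ρ e = 0 by ring, Real.exp_zero, Complex.ofReal_one]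

/-- `diag(e^{−κρ})·diag(e^{κρ}) = 1`. [folklore] -/
theorem wdiag_neg_mul_wdiag (κ : ℝ) (ρ : ι → ℝ) : wdiag (-κ) ρ * wdiag κ ρ = 1 := by
  have h := wdiag_mul_wdiag_neg (-κ) ρ
  rwa [neg_neg] at h

/-- **`conjMat κ ρ σ X = diag(e^{κρ})·X·diag(e^{−κσ})`**. [folklore] -/
theorem conjMat_eq_diag_mul (κ : ℝ) (ρ : τ → ℝ) (σ : ι → ℝ) (X : Matrix τ ι ℂ) :
    conjMat κ ρ σ X = wdiag κ ρ * X * wdiag (-κ) σ := by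
  ext e e'
  simp only [wdiag, Matrix.mul_diagonal, Matrix.diagonal_mul, conjMat_apply]
  rw [show κ * (ρ e - σ e') = κ * ρ e + -κ * σ e' by ring, Real.exp_add, Complex.ofReal_mul]
  ring

/-- **inverse rule**: `conjMat κ ρ ρ K⁻¹ = (conjMat κ ρ ρ K)⁻¹` (a conjugation by an invertible diagonal). [folklore] -/
theorem conjMat_inv (κ : ℝ) (ρ : ι → ℝ) (K : Matrix ι ι ℂ) : conjMat κ ρ ρ K⁻¹ = (conjMat κ ρ ρ K)⁻¹ := by
  rw [conjMat_eq_diag_mul, conjMat_eq_diag_mul, Matrix.mul_inv_rev, Matrix.mul_inv_rev,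
    Matrix.inv_eq_left_inv (wdiag_mul_wdiag_neg κ ρ), Matrix.inv_eq_left_inv (wdiag_neg_mul_wdiag κ ρ), Matrix.mul_assoc]

omit [Fintype ι] [DecidableEq ι] [Fintype τ] [DecidableEq τ] in
/-- **adjoint rule**: `conjMat κ σ ρ Xᴴ = (conjMat (−κ) ρ σ X)ᴴ`. [folklore] -/
theorem conjMat_conjTranspose (κ : ℝ) (ρ : τ → ℝ) (σ : ι → ℝ) (X : Matrix τ ι ℂ) :
    conjMat κ σ ρ Xᴴ = (conjMat (-κ) ρ σ X)ᴴ := by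
  ext e' e
  rw [conjMat_apply, Matrix.conjTranspose_apply, Matrix.conjTranspose_apply, conjMat_apply, star_mul', Complex.star_def, Complex.conj_ofReal,
    show -κ * (ρ e - σ e') = κ * (σ e' - ρ e) by ring]

omit [Fintype ι] [DecidableEq ι] [Fintype τ] [DecidableEq τ] in
/-- a kernel supported where the two weights AGREE is fixed by the conjugation (site-diagonal pieces, `siteMul`). [folklore] -/
theorem conjMat_of_sameWeight (κ : ℝ) (ρ : τ → ℝ) (σ : ι → ℝ) (X : Matrix τ ι ℂ) (h : ∀ e e', X e e' ≠ 0 → ρ e = σ e') :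
    conjMat κ ρ σ X = X := by
  ext e e'
  rw [conjMat_apply]
  by_cases hX : X e e' = 0
  · rw [hX, mul_zero]
  · rw [h e e' hX, sub_self, mul_zero, Real.exp_zero, Complex.ofReal_one, one_mul]

omit [DecidableEq τ] in
/-- **the bridge**: a weighted bound `‖e^{κρ}·Xv‖ ≤ C·‖e^{κσ}·v‖` for all `v` IS `‖conjMat κ ρ σ X‖ ≤ C`. [folklore] -/
theorem opNorm_conjMat_le_of_wbound (κ : ℝ) (ρ : τ → ℝ) (σ : ι → ℝ) (X : Matrix τ ι ℂ) {C : ℝ} (hC : 0 ≤ C)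
    (h : ∀ v : ι → ℂ, Real.sqrt (nsq (wvec κ ρ (X *ᵥ v))) ≤ C * Real.sqrt (nsq (wvec κ σ v))) : ‖conjMat κ ρ σ X‖ ≤ C := by
  refine opNorm_le_of_nsq_le_rect _ hC fun z => ?_
  have hv := h (wvec (-κ) σ z)
  rw [← conjMat_mulVec, wvec_wvec_neg] at hv
  have h0 : 0 ≤ Real.sqrt (nsq (conjMat κ ρ σ X *ᵥ z)) := Real.sqrt_nonneg _
  have h1 := mul_self_le_mul_self h0 hv
  rw [Real.mul_self_sqrt (nsq_nonneg _), mul_mul_mul_comm, Real.mul_self_sqrt (nsq_nonneg _), ← sq] at h1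
  exact h1

omit [DecidableEq τ] in
/-- norm control: `‖cX‖ ≤ ‖X‖ + ‖cX − X‖`. [folklore] -/
theorem opNorm_conjMat_le_add (κ : ℝ) (ρ : τ → ℝ) (σ : ι → ℝ) (X : Matrix τ ι ℂ) :
    ‖conjMat κ ρ σ X‖ ≤ ‖X‖ + ‖conjMat κ ρ σ X - X‖ := by
  calc ‖conjMat κ ρ σ X‖ = ‖X + (conjMat κ ρ σ X - X)‖ := by rw [add_sub_cancel]
    _ ≤ ‖X‖ + ‖conjMat κ ρ σ X - X‖ := norm_add_le _ _

omit [DecidableEq τ] in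
/-- **the product rule**: `‖c(XY) − XY‖ ≤ ‖cX − X‖·‖cY‖ + ‖X‖·‖cY − Y‖`. [folklore] -/
theorem opNorm_conjMat_mul_sub_le {υ : Type*} [Fintype υ] [DecidableEq υ] (κ : ℝ) (ρ : τ → ℝ) (σ : ι → ℝ) (ν : υ → ℝ)
    (X : Matrix τ ι ℂ) (Y : Matrix ι υ ℂ) :
    ‖conjMat κ ρ ν (X * Y) - X * Y‖ ≤ ‖conjMat κ ρ σ X - X‖ * ‖conjMat κ σ ν Y‖ + ‖X‖ * ‖conjMat κ σ ν Y - Y‖ := by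
  rw [conjMat_mul κ ρ σ ν, show conjMat κ ρ σ X * conjMat κ σ ν Y - X * Y
      = (conjMat κ ρ σ X - X) * conjMat κ σ ν Y + X * (conjMat κ σ ν Y - Y) by
    simp only [Matrix.sub_mul, Matrix.mul_sub]; abel]
  exact (norm_add_le _ _).trans (add_le_add (Matrix.l2_opNorm_mul _ _) (Matrix.l2_opNorm_mul _ _))

/-- the conjugated matrix stays coercive up to the conjugation error. [folklore] -/
theorem coercive_conjMat {K : Matrix ι ι ℂ} {σ₀ δ : ℝ} (hK : Coercive σ₀ K) (κ : ℝ) (ρ : ι → ℝ) (hδ : ‖conjMat κ ρ ρ K - K‖ ≤ δ) :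
    Coercive (σ₀ - δ) (conjMat κ ρ ρ K) := by
  intro x
  have h1 := hK x
  have h2 : |(star x ⬝ᵥ ((conjMat κ ρ ρ K - K) *ᵥ x)).re| ≤ δ * nsq x := by
    have h := Literature.MathematicalPhysics.QuantumFieldTheory.Balaban1983to89.B5Prop11Lower.norm_form_le (conjMat κ ρ ρ K - K) x x
    have hsq : Real.sqrt (nsq x) * Real.sqrt (nsq x) = nsq x := Real.mul_self_sqrt (nsq_nonneg _)
    calc |(star x ⬝ᵥ ((conjMat κ ρ ρ K - K) *ᵥ x)).re| ≤ ‖star x ⬝ᵥ ((conjMat κ ρ ρ K - K) *ᵥ x)‖ := Complex.abs_re_le_norm _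
      _ ≤ ‖conjMat κ ρ ρ K - K‖ * (Real.sqrt (nsq x) * Real.sqrt (nsq x)) := h
      _ ≤ δ * nsq x := by rw [hsq]; exact mul_le_mul_of_nonneg_right hδ (nsq_nonneg _)
  have e : conjMat κ ρ ρ K = K + (conjMat κ ρ ρ K - K) := by abel
  rw [e, Matrix.add_mulVec, dotProduct_add, Complex.add_re, sub_mul]
  rw [abs_le] at h2
  linarith [h2.1]

/-- **the inverse rule, size**: `Coercive σ₀ K`, `‖cK − K‖ ≤ δ < σ₀` ⟹ `‖(cK)⁻¹‖ ≤ (σ₀ − δ)⁻¹`. [folklore] -/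
theorem opNorm_conjMat_inv_le {K : Matrix ι ι ℂ} {σ₀ δ : ℝ} (hK : Coercive σ₀ K) (κ : ℝ) (ρ : ι → ℝ) (hδ : ‖conjMat κ ρ ρ K - K‖ ≤ δ)
    (hσ : δ < σ₀) : ‖(conjMat κ ρ ρ K)⁻¹‖ ≤ (σ₀ - δ)⁻¹ :=
  opNorm_inv_le_of_coercive (by linarith) (coercive_conjMat hK κ ρ hδ)

/-- **the inverse rule, difference**: `‖(cK)⁻¹ − K⁻¹‖ ≤ (σ₀ − δ)⁻¹·δ·σ₀⁻¹`. [folklore] -/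
theorem opNorm_conjMat_inv_sub_le {K : Matrix ι ι ℂ} {σ₀ δ : ℝ} (hσ₀ : 0 < σ₀) (hK : Coercive σ₀ K) (κ : ℝ) (ρ : ι → ℝ)
    (hδ : ‖conjMat κ ρ ρ K - K‖ ≤ δ) (hσ : δ < σ₀) :
    ‖conjMat κ ρ ρ K⁻¹ - K⁻¹‖ ≤ (σ₀ - δ)⁻¹ * δ * σ₀⁻¹ := by
  have hcU : IsUnit (conjMat κ ρ ρ K).det := (Matrix.isUnit_iff_isUnit_det _).mp (isUnit_of_coercive (by linarith) (coercive_conjMat hK κ ρ hδ))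
  have hKU : IsUnit K.det := (Matrix.isUnit_iff_isUnit_det _).mp (isUnit_of_coercive hσ₀ hK)
  rw [conjMat_inv, GaugeTermResolventBounds.inv_sub_inv_eq' hcU hKU]
  calc ‖(conjMat κ ρ ρ K)⁻¹ * (K - conjMat κ ρ ρ K) * K⁻¹‖ ≤ ‖(conjMat κ ρ ρ K)⁻¹ * (K - conjMat κ ρ ρ K)‖ * ‖K⁻¹‖ := Matrix.l2_opNorm_mul _ _
    _ ≤ (‖(conjMat κ ρ ρ K)⁻¹‖ * ‖K - conjMat κ ρ ρ K‖) * ‖K⁻¹‖ := mul_le_mul_of_nonneg_right (Matrix.l2_opNorm_mul _ _) (norm_nonneg _)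
    _ ≤ ((σ₀ - δ)⁻¹ * δ) * σ₀⁻¹ := by
        have hδ' : ‖K - conjMat κ ρ ρ K‖ ≤ δ := by rw [← norm_neg, neg_sub]; exact hδ
        have hδ0 : 0 ≤ δ := (norm_nonneg _).trans hδ
        exact mul_le_mul (mul_le_mul (opNorm_conjMat_inv_le hK κ ρ hδ hσ) hδ' (norm_nonneg _) (by rw [inv_nonneg]; linarith))
          (opNorm_inv_le_of_coercive hσ₀ hK) (norm_nonneg _) (by positivity)
    _ = (σ₀ - δ)⁻¹ * δ * σ₀⁻¹ := by ring

end Algebra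

/-! ## §2 The Schur conjugation bound -/

section Schur

variable {ι τ : Type*} [Fintype ι] [DecidableEq ι] [Fintype τ] [DecidableEq τ]

omit [Fintype ι] [DecidableEq ι] [Fintype τ] [DecidableEq τ] in
/-- `e^{L} + e^{−L} ≥ 2`. [folklore] -/
theorem two_le_exp_add_exp_neg (L : ℝ) : 2 ≤ Real.exp L + Real.exp (-L) := by
  have ha := Real.exp_pos L
  have hb := Real.exp_pos (-L)
  have hprod : Real.exp L * Real.exp (-L) = 1 := by rw [← Real.exp_add, add_neg_cancel, Real.exp_zero]
  nlinarith [sq_nonneg (Real.exp L - Real.exp (-L)), sq_nonneg (Real.exp L + Real.exp (-L) - 2)]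

omit [Fintype ι] [DecidableEq ι] [Fintype τ] [DecidableEq τ] in
/-- `|e^{κt} − 1| ≤ e^{|κ|ℓ} − 1` for `|t| ≤ ℓ`. [folklore] -/
theorem abs_exp_mul_sub_one_le {κ t ℓ : ℝ} (ht : |t| ≤ ℓ) : |Real.exp (κ * t) - 1| ≤ Real.exp (|κ| * ℓ) - 1 := by
  have hb : |κ * t| ≤ |κ| * ℓ := by rw [abs_mul]; exact mul_le_mul_of_nonneg_left ht (abs_nonneg κ)
  rw [abs_le] at hb ⊢
  constructor
  · have h1 : Real.exp (-(|κ| * ℓ)) ≤ Real.exp (κ * t) := Real.exp_le_exp.mpr hb.1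
    linarith [two_le_exp_add_exp_neg (|κ| * ℓ)]
  · linarith [Real.exp_le_exp.mpr hb.2]

omit [Fintype ι] [DecidableEq ι] [Fintype τ] [DecidableEq τ] in
/-- `e^t − 1 ≤ t·e^t` for `t ≥ 0`, hence `n(e^{a/n} − 1) ≤ a·e^{a/n} ≤ a·e^{a}` (`a ≥ 0`, `n ≥ 1`). [folklore] -/
theorem nat_mul_exp_div_sub_one_le {a : ℝ} (ha : 0 ≤ a) {n : ℕ} (hn : 1 ≤ n) :
    (n : ℝ) * (Real.exp (a / n) - 1) ≤ a * Real.exp a := by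
  have hn0 : (0 : ℝ) < n := by exact_mod_cast hn
  have hn1 : (1 : ℝ) ≤ n := by exact_mod_cast hn
  set t := a / n with ht
  have ht0 : 0 ≤ t := by positivity
  have h1 : Real.exp t - 1 ≤ t * Real.exp t := by
    have h := Real.add_one_le_exp (-t)
    have hpos := Real.exp_pos t
    have hprod : Real.exp (-t) * Real.exp t = 1 := by rw [← Real.exp_add, neg_add_cancel, Real.exp_zero]
    nlinarith
  have hta : t ≤ a := by rw [ht]; exact div_le_self ha hn1
  calc (n : ℝ) * (Real.exp t - 1) ≤ n * (t * Real.exp t) := mul_le_mul_of_nonneg_left h1 hn0.le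
    _ = a * Real.exp t := by rw [ht]; field_simp
    _ ≤ a * Real.exp a := mul_le_mul_of_nonneg_left (Real.exp_le_exp.mpr hta) ha

omit [DecidableEq τ] in
/-- **SCHUR CONJUGATION BOUND**: if `|ρ_e − σ_{e′}| ≤ ℓ` (`ℓ ≥ 0`) wherever `X(e,e′) ≠ 0` and the absolute row ∕ column sums of `X` are `≤ R`, `≤ C`,
then `‖conjMat κ ρ σ X − X‖ ≤ (e^{|κ|ℓ} − 1)·√(RC)`. [folklore] -/
theorem opNorm_conjMat_sub_le_schur (κ : ℝ) (ρ : τ → ℝ) (σ : ι → ℝ) (X : Matrix τ ι ℂ) {ℓ R C : ℝ} (hℓ : 0 ≤ ℓ) (hR : 0 ≤ R) (hC : 0 ≤ C)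
    (hsupp : ∀ e e', X e e' ≠ 0 → |ρ e - σ e'| ≤ ℓ) (hrow : ∀ e, ∑ e', ‖X e e'‖ ≤ R) (hcol : ∀ e', ∑ e, ‖X e e'‖ ≤ C) :
    ‖conjMat κ ρ σ X - X‖ ≤ (Real.exp (|κ| * ℓ) - 1) * Real.sqrt (R * C) := by
  set θ : ℝ := Real.exp (|κ| * ℓ) - 1 with hθ
  have hθ0 : 0 ≤ θ := by rw [hθ]; linarith [Real.one_le_exp (mul_nonneg (abs_nonneg κ) hℓ)]
  have hentry : ∀ e e', ‖(conjMat κ ρ σ X - X) e e'‖ ≤ θ * ‖X e e'‖ := by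
    intro e e'
    rw [Matrix.sub_apply, conjMat_apply, show ((Real.exp (κ * (ρ e - σ e')) : ℝ) : ℂ) * X e e' - X e e'
        = (((Real.exp (κ * (ρ e - σ e')) - 1 : ℝ)) : ℂ) * X e e' by push_cast; ring, norm_mul, Complex.norm_real, Real.norm_eq_abs]
    by_cases hX : X e e' = 0
    · rw [hX, norm_zero, mul_zero, mul_zero]
    · exact mul_le_mul_of_nonneg_right (abs_exp_mul_sub_one_le (hsupp e e' hX)) (norm_nonneg _)
  have hrow' : ∀ e, ∑ e', ‖(conjMat κ ρ σ X - X) e e'‖ ≤ θ * R := fun e =>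
    calc ∑ e', ‖(conjMat κ ρ σ X - X) e e'‖ ≤ ∑ e', θ * ‖X e e'‖ := Finset.sum_le_sum fun e' _ => hentry e e'
      _ = θ * ∑ e', ‖X e e'‖ := by rw [Finset.mul_sum]
      _ ≤ θ * R := mul_le_mul_of_nonneg_left (hrow e) hθ0
  have hcol' : ∀ e', ∑ e, ‖(conjMat κ ρ σ X - X) e e'‖ ≤ θ * C := fun e' =>
    calc ∑ e, ‖(conjMat κ ρ σ X - X) e e'‖ ≤ ∑ e, θ * ‖X e e'‖ := Finset.sum_le_sum fun e _ => hentry e e'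
      _ = θ * ∑ e, ‖X e e'‖ := by rw [Finset.mul_sum]
      _ ≤ θ * C := mul_le_mul_of_nonneg_left (hcol e') hθ0
  calc ‖conjMat κ ρ σ X - X‖ ≤ Real.sqrt ((θ * R) * (θ * C)) := opNorm_le_sqrt_of_schur _ (by positivity) (by positivity) hrow' hcol'
    _ = θ * Real.sqrt (R * C) := by
        rw [show (θ * R) * (θ * C) = θ ^ 2 * (R * C) by ring, Real.sqrt_mul (sq_nonneg _), Real.sqrt_sq hθ0]

/-- the adjoint inherits the bound (`‖Yᴴ‖ = ‖Y‖`, `conjMat κ σ ρ Xᴴ = (conjMat (−κ) ρ σ X)ᴴ`). [folklore] -/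
theorem opNorm_conjMat_conjTranspose_sub_eq (κ : ℝ) (ρ : τ → ℝ) (σ : ι → ℝ) (X : Matrix τ ι ℂ) :
    ‖conjMat κ σ ρ Xᴴ - Xᴴ‖ = ‖conjMat (-κ) ρ σ X - X‖ := by
  rw [conjMat_conjTranspose, ← Matrix.conjTranspose_sub, Matrix.l2_opNorm_conjTranspose]

end Schur

end Summit.QuantumFields.BalabanUV.T4Continuum.CTConjugationPieces

end
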